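import Summits.CriticalPhenomena.PercolationContinuityZ3.Theorems.PercNearOneGluingNoHeavyQuantIndepBlobHeavyLine
import HarnessLib

/-!
# QUANT lane R8, T-DIB: the chord certificate for a system with two distinguished blobs — the restricted tail of a pair in
# closed form, and `P(N ≥ j+1) ≥ x` from finitely many explicit chord inequalities

builds on p205010 (kernel theorem, internal audit signed; external expert review pending)

Support file (`--supports stmt-CriticalPhenomena-4575`), QUANT lane seat prim-quant-p1 (gen 12); memo
`run/shared/lean/prim/quant/P1-SURPLUS.md` §23.5.  Theorems only; no definitions, no sorries, standard axioms.  Continues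
`…QuantIndepBlobHeavyLine` (the two-point reduction of the heavy side: `tail_ge_of_heavyChords`).

For the open corner of Conjecture DIB\* (`…QuantDIBStar`) with exactly TWO sub-floor blobs `ℓ₁, ℓ₂` the light side is `S = {ℓ₁, ℓ₂}`,
whose restricted tail is explicit:
`TL_S(t) = p₁p₂·𝟙[t ≤ a₁+a₂] + p₁(1−p₂)·𝟙[t ≤ a₁] + (1−p₁)p₂·𝟙[t ≤ a₂] + (1−p₁)(1−p₂)·𝟙[t ≤ 0]` (`tailU_pair`).
Feeding this into `tail_ge_of_heavyChords` gives `tail_ge_of_pairChords`: the row `x ≤ P(N ≥ j+1)` follows from the finitely many chord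
inequalities `x·(n₂ − n₁) ≤ (n₂ − m')·TL_S(j+1−n₁) + (m' − n₁)·TL_S(j+1−n₂)` (`n₁ < m' < n₂ ≤ A'`, `m'`/`A'` the mean open mass / total size
of the other blobs), now a statement about real numbers only.  P1-SURPLUS §23.5 lists the seven cells of this statement in the corner
(values of `TL_S` in `{0, p₁p₂, p₁, 1 − (1−p₁)(1−p₂), 1}`) and their numerical margins (`≥ 0.22·(1−x)` when neither light is heavy-mergeable).

* `Quant.IndepBlob.tailU_empty'` — `TL_∅(t) = 𝟙[t ≤ 0]`;  `Quant.IndepBlob.tailU_pair` — the closed form above.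
* `Quant.IndepBlob.tail_ge_of_pairChords` — the chord certificate with `S = {ℓ₁, ℓ₂}` written out.
[cite: KozmaNitzan2024, Conjecture 3 (p. 15)] (the gluing rows served); the lemmas are [this work].
-/

namespace Summit.CriticalPhenomena.PercolationContinuityZ3.Theorems

namespace Quant

namespace IndepBlob

open Finset

variable {κ : Type*} [DecidableEq κ]

/-- The restricted tail of the EMPTY finset: `TL_∅(t) = 𝟙[t ≤ 0]`. [this work] -/
theorem tailU_empty' (p : κ → ℝ) (a : κ → ℕ) (t : ℕ) :
    ∑ s ∈ (∅ : Finset κ).powerset, (∏ i ∈ (∅ : Finset κ), (if i ∈ s then p i else 1 - p i)) *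
        (if t ≤ ∑ i ∈ s, a i then (1 : ℝ) else 0) = (if t ≤ 0 then (1 : ℝ) else 0) := by
  rw [Finset.powerset_empty, Finset.sum_singleton, Finset.prod_empty, Finset.sum_empty, one_mul]

/-- **The restricted tail of a pair.**  For `ℓ₁ ≠ ℓ₂`:
`TL_{{ℓ₁,ℓ₂}}(t) = p₁p₂·𝟙[t ≤ a₁+a₂] + p₁(1−p₂)·𝟙[t ≤ a₁] + (1−p₁)p₂·𝟙[t ≤ a₂] + (1−p₁)(1−p₂)·𝟙[t ≤ 0]`. [this work] -/
theorem tailU_pair (p : κ → ℝ) (a : κ → ℕ) (ℓ₁ ℓ₂ : κ) (hne : ℓ₁ ≠ ℓ₂) (t : ℕ) :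
    ∑ s ∈ (insert ℓ₂ (insert ℓ₁ (∅ : Finset κ))).powerset,
        (∏ i ∈ insert ℓ₂ (insert ℓ₁ (∅ : Finset κ)), (if i ∈ s then p i else 1 - p i)) *
        (if t ≤ ∑ i ∈ s, a i then (1 : ℝ) else 0) =
      p ℓ₁ * p ℓ₂ * (if t ≤ a ℓ₁ + a ℓ₂ then (1 : ℝ) else 0) + p ℓ₁ * (1 - p ℓ₂) * (if t ≤ a ℓ₁ then (1 : ℝ) else 0) +
      (1 - p ℓ₁) * p ℓ₂ * (if t ≤ a ℓ₂ then (1 : ℝ) else 0) + (1 - p ℓ₁) * (1 - p ℓ₂) * (if t ≤ 0 then (1 : ℝ) else 0) := by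
  have hℓ₁ : ℓ₁ ∉ (∅ : Finset κ) := Finset.notMem_empty _
  have hℓ₂ : ℓ₂ ∉ insert ℓ₁ (∅ : Finset κ) := by
    rw [Finset.mem_insert]; exact fun h => h.elim (fun h' => hne h'.symm) (Finset.notMem_empty _)
  rw [tailU_insert p a (insert ℓ₁ ∅) ℓ₂ hℓ₂ t, tailU_insert p a ∅ ℓ₁ hℓ₁ (t - a ℓ₂), tailU_insert p a ∅ ℓ₁ hℓ₁ t,
    tailU_empty' p a (t - a ℓ₂ - a ℓ₁), tailU_empty' p a (t - a ℓ₂), tailU_empty' p a (t - a ℓ₁), tailU_empty' p a t]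
  have h1 : (t - a ℓ₂ - a ℓ₁ ≤ 0) ↔ (t ≤ a ℓ₁ + a ℓ₂) := by omega
  have h2 : (t - a ℓ₂ ≤ 0) ↔ (t ≤ a ℓ₂) := by omega
  have h3 : (t - a ℓ₁ ≤ 0) ↔ (t ≤ a ℓ₁) := by omega
  simp only [h1, h2, h3]
  ring

/-- **THE CHORD CERTIFICATE FOR TWO DISTINGUISHED BLOBS.**  Gates in `[0,1]`; `ℓ₁ ≠ ℓ₂` two blobs (any gates), `A' = Σ_{k ≠ ℓ₁,ℓ₂} a k`,
`m' = Σ_{k ≠ ℓ₁,ℓ₂} a k·p k`, and `F(t) = p₁p₂·𝟙[t ≤ a₁+a₂] + p₁(1−p₂)·𝟙[t ≤ a₁] + (1−p₁)p₂·𝟙[t ≤ a₂] + (1−p₁)(1−p₂)·𝟙[t ≤ 0]` the tail of the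
pair.  If `x ≤ F(j+1−n)` for the integer `n = m'` (if any) and every chord through `m'` lies above `x`,
`x·(n₂ − n₁) ≤ (n₂ − m')·F(j+1−n₁) + (m' − n₁)·F(j+1−n₂)` for all integers `n₁ < m' < n₂ ≤ A'`, then `x ≤ P(N ≥ j+1)`.
(`tail_ge_of_heavyChords` with `S = {ℓ₁, ℓ₂}` and `tailU_pair`.) [this work] -/
theorem tail_ge_of_pairChords [Fintype κ] (p : κ → ℝ) (a : κ → ℕ) (hp0 : ∀ i, 0 ≤ p i) (hp1 : ∀ i, p i ≤ 1)
    (ℓ₁ ℓ₂ : κ) (hne : ℓ₁ ≠ ℓ₂) (j : ℕ) (x : ℝ)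
    (hint : ∀ n : ℕ, n ≤ ∑ k ∈ (insert ℓ₂ (insert ℓ₁ (∅ : Finset κ)))ᶜ, a k →
      (n : ℝ) = ∑ k ∈ (insert ℓ₂ (insert ℓ₁ (∅ : Finset κ)))ᶜ, (a k : ℝ) * p k →
      x ≤ p ℓ₁ * p ℓ₂ * (if j + 1 - n ≤ a ℓ₁ + a ℓ₂ then (1 : ℝ) else 0) +
          p ℓ₁ * (1 - p ℓ₂) * (if j + 1 - n ≤ a ℓ₁ then (1 : ℝ) else 0) +
          (1 - p ℓ₁) * p ℓ₂ * (if j + 1 - n ≤ a ℓ₂ then (1 : ℝ) else 0) +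
          (1 - p ℓ₁) * (1 - p ℓ₂) * (if j + 1 - n ≤ 0 then (1 : ℝ) else 0))
    (hchord : ∀ n₁ n₂ : ℕ, (n₁ : ℝ) < ∑ k ∈ (insert ℓ₂ (insert ℓ₁ (∅ : Finset κ)))ᶜ, (a k : ℝ) * p k →
      (∑ k ∈ (insert ℓ₂ (insert ℓ₁ (∅ : Finset κ)))ᶜ, (a k : ℝ) * p k) < (n₂ : ℝ) →
      n₂ ≤ ∑ k ∈ (insert ℓ₂ (insert ℓ₁ (∅ : Finset κ)))ᶜ, a k →
      x * ((n₂ : ℝ) - n₁) ≤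
        ((n₂ : ℝ) - ∑ k ∈ (insert ℓ₂ (insert ℓ₁ (∅ : Finset κ)))ᶜ, (a k : ℝ) * p k) *
            (p ℓ₁ * p ℓ₂ * (if j + 1 - n₁ ≤ a ℓ₁ + a ℓ₂ then (1 : ℝ) else 0) +
              p ℓ₁ * (1 - p ℓ₂) * (if j + 1 - n₁ ≤ a ℓ₁ then (1 : ℝ) else 0) +
              (1 - p ℓ₁) * p ℓ₂ * (if j + 1 - n₁ ≤ a ℓ₂ then (1 : ℝ) else 0) +
              (1 - p ℓ₁) * (1 - p ℓ₂) * (if j + 1 - n₁ ≤ 0 then (1 : ℝ) else 0)) +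
          ((∑ k ∈ (insert ℓ₂ (insert ℓ₁ (∅ : Finset κ)))ᶜ, (a k : ℝ) * p k) - n₁) *
            (p ℓ₁ * p ℓ₂ * (if j + 1 - n₂ ≤ a ℓ₁ + a ℓ₂ then (1 : ℝ) else 0) +
              p ℓ₁ * (1 - p ℓ₂) * (if j + 1 - n₂ ≤ a ℓ₁ then (1 : ℝ) else 0) +
              (1 - p ℓ₁) * p ℓ₂ * (if j + 1 - n₂ ≤ a ℓ₂ then (1 : ℝ) else 0) +
              (1 - p ℓ₁) * (1 - p ℓ₂) * (if j + 1 - n₂ ≤ 0 then (1 : ℝ) else 0))) :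
    x ≤ ∑ s : Finset κ, (∏ i, (if i ∈ s then p i else 1 - p i)) * (if j + 1 ≤ ∑ i ∈ s, a i then (1 : ℝ) else 0) := by
  set S : Finset κ := insert ℓ₂ (insert ℓ₁ (∅ : Finset κ)) with hS
  refine tail_ge_of_heavyChords p a hp0 hp1 S j x (fun n hn hnm => ?_) (fun n₁ n₂ h1 h2 h3 => ?_)
  · rw [hS, tailU_pair p a ℓ₁ ℓ₂ hne (j + 1 - n)]
    exact hint n hn hnm
  · rw [hS, tailU_pair p a ℓ₁ ℓ₂ hne (j + 1 - n₁), tailU_pair p a ℓ₁ ℓ₂ hne (j + 1 - n₂)]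
    exact hchord n₁ n₂ h1 h2 h3

end IndepBlob

end Quant

end Summit.CriticalPhenomena.PercolationContinuityZ3.Theorems
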